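import Summits.BirchSwinnertonDyer.Rank1Residual.Supersingular.MazurTateTwistedNonvanishing
import HarnessLib

/-!
# A Mazur–Tate certificate forbids vanishing twists, part 2: ALL layers of one parity from ONE
# invariant (`λ♯ ≤ p − 2`; `λ♭ + p ≤ p(p−1)`), the `a_p = 0` forms, and the X8 readings
# (cell `b2b-bsdres`, supersingular family, prover B = unit `b2b-bsdres-additive-p3`, gen 6; part 1b)

HONEST FRAMING (run/shared/lean/b2b/bsd-rank1-residual/, verbatim in every file): the goal of the
cell is to DELETE the COMBINATION-SHAPED residual classes of the Birch–Swinnerton-Dyer formula for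
ALL analytic-rank `≤ 1` elliptic curves over `ℚ` — "full BSD formula for every rank `≤ 1` curve in
class `C`" assembled STRICTLY from published theorems — so that the rank-`≤ 1` remainder becomes
exactly the CONSTRUCTION-SHAPED classes, which are TYPED (missing-input `Prop`s), NOT attempted.
This is not "finishing BSD". THEOREMS ONLY (no named fact, no `sorry`); nothing about any particular
curve is asserted; nothing is booked; X8 / X7 / X6 stay CONSTRUCTION-SHAPED.

## What this file proves (part 1 = `MazurTateTwistedNonvanishing.lean`: the layer theorem
## `ratTwistedSymbolSum_ne_zero_of_mazurTate` and its ♯/♭ single-layer forms)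

* `natDegree_cyclotomicOmegaPlus/Minus_add_two` (`deg ω_{n+2}^± = deg ω_n^± + φ(pⁿ⁺¹)`) and the
  propagation lemmas `add_natDegree_cyclotomicOmegaPlus/Minus_lt_totient`: the layer inequality
  `l + deg ω_n^± < φ(pⁿ)` passes from `n` to `n + 2` because `φ(pⁿ) + φ(pⁿ⁺¹) ≤ φ(pⁿ⁺²)`; its base
  cases are `l + 2 ≤ p` (`♯`, `n = 1`) and `l + p ≤ p(p − 1)` (`♭`, `n = 2`).
* `forall_odd_ratTwistedSymbolSum_ne_zero_of_lam_sharp_le`: `p ≠ 2` good, `p ∣ a_p`, THE Sprung pair,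
  `L♯ ≠ 0`, `μ(L♯) = 0`, **`λ(L♯) ≤ p − 2`** ⇒ for EVERY odd `n` and every character `χ` of `Γ` of
  order `pⁿ` (primitive of conductor `p^{n+1}`, even, `p`-power order, values in `ℂ_p`):
  `∑_a χ(a)[a/p^{n+1}]⁺_f ≠ 0`; `forall_even_…_of_lam_flat_le`: **`λ(L♭) + p ≤ p(p−1)`** ⇒ the same at
  every even `n ≥ 2`.
* `forall_odd/even_ratTwistedSymbolSum_ne_zero_of_lam_signed_neg_one/one_le`: the `a_p = 0` forms for
  Kobayashi–Pollack's `L_p^ε` (`IsSignedPAdicLFunction`; X6 / X7), via Pollack's theorem and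
  `isSprungPair_zero_iff`.
* `X8.forall_odd_ratTwistedSymbolSum_ne_zero_of_lam_sharp_le_one` (`λ♯ ≤ 1`),
  `X8.forall_even_ratTwistedSymbolSum_ne_zero_of_lam_flat_le_three` (`λ♭ ≤ 3`).

READING (census N < 2·10⁴, kernel records `MazurTateRecords.lean`, two engines; nothing booked): of
the 39 X8 rank-one pairs, `λ♯ = 1` on 21 (⇒ no vanishing twist at ANY odd layer), `λ♭ ∈ {1, 3}` on
23 + 9 = 32 (⇒ none at any even layer `≥ 2`); both on 19 + (the `(1,3)` and `(3,1)`… pairs with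
`λ♯ = 1`) — precisely: `(λ♯, λ♭) = (1, 1)` on 19 pairs and `(1, 3)` on 2, so on **21 pairs no character
of `Gal(ℚ_∞/ℚ)` at all twists `L(E, s)` to vanish at `s = 1`**, while `L(E, 1) = 0`. X7 (a_p = 0):
`(1, 1)` on 11 pairs at `p = 3`, 9 at `p = 5`, 3 at `p = 7`, 3 at `p = 11` (there `λ ≤ p − 2` holds
for larger `λ` too). Part 2 of gen 6 (complex side, Kato's Cor. 14.3) draws the Mordell–Weil
consequence in the tower.

References: as in part 1 ([Pollack2003] Prop. 6.9/6.10/6.18, Cor. 5.11; [Sprung2017] §3, Cor. 3.6;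
[MazurTateTeitelbaum1986Invent] §I.13; Kurihara–Pollack 2007 §0.3). Memo: X8-ROUTE-B.md §11.
-/

set_option autoImplicit false

noncomputable section

open scoped Classical MatrixGroups ModularForm

open CongruenceSubgroup Polynomial WeierstrassCurve Literature.NumberTheory.EllipticCurves
  Literature.NumberTheory.EllipticCurves.ModularForms
  Literature.NumberTheory.EllipticCurves.Sprung2017
  Literature.NumberTheory.EllipticCurves.Rank1Residual
  Summit.BirchSwinnertonDyer.Rank1Residual.X1.MuLambda

namespace Summit.BirchSwinnertonDyer.Rank1Residual.Supersingular

/-! ## §4. All layers of one parity from ONE invariant -/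

section AllLayers

variable (p : ℕ) [hp : Fact p.Prime]

omit hp in
/-- `deg ω_{n+2}^+ = deg ω_n^+ + φ(pⁿ⁺¹)` for odd `n` (the new factor `Φ_{p^{n+1}}(1+T)`). [cite: Pollack2003, §6.5 and Lemma 4.7] -/
theorem natDegree_cyclotomicOmegaPlus_add_two {n : ℕ} (hn : Odd n) :
    (cyclotomicOmegaPlus p (n + 2)).natDegree =
      (cyclotomicOmegaPlus p n).natDegree + Nat.totient (p ^ (n + 1)) := by
  obtain ⟨m, rfl⟩ := hn
  rw [natDegree_cyclotomicOmegaPlus, natDegree_cyclotomicOmegaPlus,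
    show (2 * m + 1 + 2) / 2 = (2 * m + 1) / 2 + 1 by omega,
    Finset.sum_Icc_succ_top (by omega), show 2 * ((2 * m + 1) / 2 + 1) = 2 * m + 1 + 1 by omega]

omit hp in
/-- `deg ω_{n+2}^- = deg ω_n^- + φ(pⁿ⁺¹)` for even `n`. [cite: Pollack2003, §6.5 and Lemma 4.7] -/
theorem natDegree_cyclotomicOmegaMinus_add_two {n : ℕ} (hn : Even n) :
    (cyclotomicOmegaMinus p (n + 2)).natDegree =
      (cyclotomicOmegaMinus p n).natDegree + Nat.totient (p ^ (n + 1)) := by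
  obtain ⟨m, rfl⟩ := hn
  rw [natDegree_cyclotomicOmegaMinus, natDegree_cyclotomicOmegaMinus,
    show (m + m + 2 + 1) / 2 = (m + m + 1) / 2 + 1 by omega,
    Finset.sum_Icc_succ_top (by omega), show 2 * ((m + m + 1) / 2 + 1) - 1 = m + m + 1 by omega]

/-- **Propagation along the odd layers**: `l + deg ω_1^+ < φ(p)` (i.e. `l + 1 < p`) implies
`l + deg ω_n^+ < φ(pⁿ)` for every odd `n`. [folklore] -/
theorem add_natDegree_cyclotomicOmegaPlus_lt_totient {l : ℕ} (hl : l + 2 ≤ p) {n : ℕ} (hn : Odd n) :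
    l + (cyclotomicOmegaPlus p n).natDegree < Nat.totient (p ^ n) := by
  obtain ⟨m, rfl⟩ := hn
  induction m with
  | zero =>
    have h0 : (cyclotomicOmegaPlus p (2 * 0 + 1)).natDegree = 0 := by
      rw [natDegree_cyclotomicOmegaPlus]; rfl
    rw [h0, add_zero, show 2 * 0 + 1 = 1 by rfl, pow_one, Nat.totient_prime hp.out]
    omega
  | succ m ih =>
    rw [show 2 * (m + 1) + 1 = (2 * m + 1) + 2 by ring,
      natDegree_cyclotomicOmegaPlus_add_two p ⟨m, by ring⟩, ← add_assoc]
    have hstep := totient_add_totient_succ_le hp.out (n := 2 * m + 1) (by omega)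
    omega

/-- **Propagation along the even layers `n ≥ 2`**: `l + deg ω_2^- < φ(p²)` (i.e. `l + p ≤ p(p−1)`)
implies `l + deg ω_n^- < φ(pⁿ)` for every even `n ≥ 2`. [folklore] -/
theorem add_natDegree_cyclotomicOmegaMinus_lt_totient {l : ℕ} (hl : l + p ≤ p * (p - 1)) {n : ℕ}
    (hn : Even n) (hn0 : 0 < n) :
    l + (cyclotomicOmegaMinus p n).natDegree < Nat.totient (p ^ n) := by
  obtain ⟨m', rfl⟩ := hn
  obtain ⟨m, rfl⟩ : ∃ m, m' = m + 1 := ⟨m' - 1, by omega⟩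
  induction m with
  | zero =>
    have h2 : (cyclotomicOmegaMinus p (0 + 1 + (0 + 1))).natDegree = p - 1 := by
      rw [natDegree_cyclotomicOmegaMinus, show (0 + 1 + (0 + 1) + 1) / 2 = 1 by rfl,
        Finset.Icc_self, Finset.sum_singleton, show 2 * 1 - 1 = 1 by rfl, pow_one,
        Nat.totient_prime hp.out]
    rw [h2, show 0 + 1 + (0 + 1) = 2 by rfl, Nat.totient_prime_pow_succ hp.out, pow_one]
    have h1 : 1 ≤ p := hp.out.one_le
    omega
  | succ m ih =>
    rw [show m + 1 + 1 + (m + 1 + 1) = (m + 1 + (m + 1)) + 2 by ring,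
      natDegree_cyclotomicOmegaMinus_add_two p ⟨m + 1, rfl⟩, ← add_assoc]
    have hstep := totient_add_totient_succ_le hp.out (n := m + 1 + (m + 1)) (by omega)
    have ih' := ih (by omega)
    omega

variable {p}
variable {W : WeierstrassCurve ℚ} [W.IsElliptic] [W.IsGloballyMinimal] {N : ℕ} [NeZero N]
  {f : CuspForm (Gamma0 N) 2}

/-- **`λ(L♯) ≤ p − 2` ⇒ NO character of `Γ` of order `pⁿ` with `n` odd has a vanishing twisted
`L`-value** (`p ≠ 2` good, `p ∣ a_p`, THE Sprung pair, `L♯ ≠ 0`, `μ(L♯) = 0`). At `p = 3`: `λ♯ = 1`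
(the tight rank-one certificate) or `λ♯ = 0`. [cite: Sprung2017, §3 and Cor. 3.6] [cite: Pollack2003, Prop. 6.9 and Prop. 6.10] -/
theorem forall_odd_ratTwistedSymbolSum_ne_zero_of_lam_sharp_le (hp2 : p ≠ 2) (hf : IsNewformOf W f)
    (hgood : W.HasGoodReductionAtPrime p) (hap : (p : ℤ) ∣ W.frobeniusTrace p)
    {Lsharp Lflat : IwasawaAlgebra p} (hSP : IsSprungPair f p (W.frobeniusTrace p) Lsharp Lflat)
    (hL0 : Lsharp ≠ 0) (hμL : mu Lsharp = 0) (hsmall : lam Lsharp + 2 ≤ p) {n : ℕ} (hn : Odd n)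
    (χ : DirichletCharacter ℂ_[p] (p ^ (n + cyclotomicExponent p))) (hχ : χ.IsPrimitive)
    (hev : χ.Even) (hord : ∃ j : ℕ, orderOf χ = p ^ j) :
    ratTwistedSymbolSum f χ ≠ 0 :=
  ratTwistedSymbolSum_ne_zero_of_lam_sharp_lt hp2 hf hgood hap hSP hL0 hμL hn
    (add_natDegree_cyclotomicOmegaPlus_lt_totient p hsmall hn) χ hχ hev hord

/-- **`λ(L♭) + p ≤ p(p − 1)` ⇒ NO character of `Γ` of order `pⁿ` with `n ≥ 2` even has a vanishing
twisted `L`-value.** At `p = 3`: `λ♭ ≤ 3`. [cite: Sprung2017, §3 and Cor. 3.6] [cite: Pollack2003, Prop. 6.9 and Prop. 6.10] -/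
theorem forall_even_ratTwistedSymbolSum_ne_zero_of_lam_flat_le (hp2 : p ≠ 2) (hf : IsNewformOf W f)
    (hgood : W.HasGoodReductionAtPrime p) (hap : (p : ℤ) ∣ W.frobeniusTrace p)
    {Lsharp Lflat : IwasawaAlgebra p} (hSP : IsSprungPair f p (W.frobeniusTrace p) Lsharp Lflat)
    (hL0 : Lflat ≠ 0) (hμL : mu Lflat = 0) (hsmall : lam Lflat + p ≤ p * (p - 1)) {n : ℕ}
    (hn : Even n) (hn0 : 0 < n)
    (χ : DirichletCharacter ℂ_[p] (p ^ (n + cyclotomicExponent p))) (hχ : χ.IsPrimitive)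
    (hev : χ.Even) (hord : ∃ j : ℕ, orderOf χ = p ^ j) :
    ratTwistedSymbolSum f χ ≠ 0 :=
  ratTwistedSymbolSum_ne_zero_of_lam_flat_lt hp2 hf hgood hap hSP hL0 hμL hn hn0
    (add_natDegree_cyclotomicOmegaMinus_lt_totient p hsmall hn hn0) χ hχ hev hord

end AllLayers

/-! ## §5. `a_p = 0` (X6 / X7): Kobayashi–Pollack's `L_p^ε` -/

section Signed

variable {W : WeierstrassCurve ℚ} [W.IsElliptic] [W.IsGloballyMinimal] {N : ℕ} [NeZero N]
  {f : CuspForm (Gamma0 N) 2} {p : ℕ} [hp : Fact p.Prime]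

open Literature.NumberTheory.EllipticCurves.Kobayashi2003 in
/-- **`a_p = 0`, `ε = −1` (Pollack's `L⁺`, ODD layers): `λ(L) ≤ p − 2` ⇒ no vanishing twist at any
odd layer** (`μ(L) = 0`; `L ≠ 0` is Pollack's Cor. 5.11). [cite: Pollack2003, Prop. 6.9, Prop. 6.18 and Cor. 5.11] -/
theorem forall_odd_ratTwistedSymbolSum_ne_zero_of_lam_signed_neg_one_le (hp2 : p ≠ 2)
    (hf : IsNewformOf W f) (hgood : W.HasGoodReductionAtPrime p) (hap : W.frobeniusTrace p = 0)
    {L : IwasawaAlgebra p} (hL : IsSignedPAdicLFunction f p (-1) L) (hμL : mu L = 0)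
    (hsmall : lam L + 2 ≤ p) {n : ℕ} (hn : Odd n)
    (χ : DirichletCharacter ℂ_[p] (p ^ (n + cyclotomicExponent p))) (hχ : χ.IsPrimitive)
    (hev : χ.Even) (hord : ∃ j : ℕ, orderOf χ = p ^ j) :
    ratTwistedSymbolSum f χ ≠ 0 := by
  obtain ⟨Lplus, Lminus, hLp0, -, hodd, heven⟩ :=
    pollack_exists_plusMinusPAdicLFunction_holds (W := W) (f := f) (p := p) hp2 hf hgood hap
  have hSP : IsSprungPair f p (W.frobeniusTrace p) Lplus Lminus := by
    rw [hap]
    exact (isSprungPair_zero_iff f p Lplus Lminus).mpr ⟨hodd, heven⟩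
  have hLeq : L = Lplus := hL.unique ((isSignedPAdicLFunction_neg_one_iff f p Lplus).mpr hodd)
  subst hLeq
  have hap' : (p : ℤ) ∣ W.frobeniusTrace p := by rw [hap]; exact dvd_zero _
  exact forall_odd_ratTwistedSymbolSum_ne_zero_of_lam_sharp_le hp2 hf hgood hap' hSP hLp0 hμL hsmall
    hn χ hχ hev hord

open Literature.NumberTheory.EllipticCurves.Kobayashi2003 in
/-- **`a_p = 0`, `ε = +1` (Pollack's `L⁻`, EVEN layers `n ≥ 2`): `λ(L) + p ≤ p(p−1)` ⇒ no vanishing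
twist at any even layer.** [cite: Pollack2003, Prop. 6.9, Prop. 6.18 and Cor. 5.11] -/
theorem forall_even_ratTwistedSymbolSum_ne_zero_of_lam_signed_one_le (hp2 : p ≠ 2)
    (hf : IsNewformOf W f) (hgood : W.HasGoodReductionAtPrime p) (hap : W.frobeniusTrace p = 0)
    {L : IwasawaAlgebra p} (hL : IsSignedPAdicLFunction f p 1 L) (hμL : mu L = 0)
    (hsmall : lam L + p ≤ p * (p - 1)) {n : ℕ} (hn : Even n) (hn0 : 0 < n)
    (χ : DirichletCharacter ℂ_[p] (p ^ (n + cyclotomicExponent p))) (hχ : χ.IsPrimitive)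
    (hev : χ.Even) (hord : ∃ j : ℕ, orderOf χ = p ^ j) :
    ratTwistedSymbolSum f χ ≠ 0 := by
  obtain ⟨Lplus, Lminus, -, hLm0, hodd, heven⟩ :=
    pollack_exists_plusMinusPAdicLFunction_holds (W := W) (f := f) (p := p) hp2 hf hgood hap
  have hSP : IsSprungPair f p (W.frobeniusTrace p) Lplus Lminus := by
    rw [hap]
    exact (isSprungPair_zero_iff f p Lplus Lminus).mpr ⟨hodd, heven⟩
  have hLeq : L = Lminus := hL.unique ((isSignedPAdicLFunction_one_iff f p Lminus).mpr heven)
  subst hLeq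
  have hap' : (p : ℤ) ∣ W.frobeniusTrace p := by rw [hap]; exact dvd_zero _
  exact forall_even_ratTwistedSymbolSum_ne_zero_of_lam_flat_le hp2 hf hgood hap' hSP hLm0 hμL hsmall
    hn hn0 χ hχ hev hord

end Signed

/-! ## §6. X8 readings (`p = 3`, `a_3 = ±3`) -/

section X8

variable {W : WeierstrassCurve ℚ} [W.IsElliptic] [W.IsGloballyMinimal] {N : ℕ} [NeZero N]
  {f : CuspForm (Gamma0 N) 2}

/-- **X8, `λ(L♯_3(E)) = 1` (the tight rank-one certificate; 21 of the 39 rank-one pairs of the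
records): no character of `Gal(ℚ_∞/ℚ)` of order `3ⁿ`, `n` odd, has `∑_a χ(a)[a/3^{n+1}]⁺ = 0`** — i.e.
(Birch) `L(E, χ, 1) ≠ 0` for all `2·3^{n−1}` such characters, every odd `n`. Nothing booked.
[cite: Sprung2017, §3 and Cor. 3.6] [cite: Pollack2003, Prop. 6.9 and Prop. 6.10] -/
theorem X8.forall_odd_ratTwistedSymbolSum_ne_zero_of_lam_sharp_le_one {p : ℕ} [Fact p.Prime]
    (hX : ClassX8 W p) (hf : IsNewformOf W f) {Lsharp Lflat : IwasawaAlgebra p}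
    (hSP : IsSprungPair f p (W.frobeniusTrace p) Lsharp Lflat) (hL0 : Lsharp ≠ 0)
    (hμ : mu Lsharp = 0) (h1 : lam Lsharp ≤ 1) {n : ℕ} (hn : Odd n)
    (χ : DirichletCharacter ℂ_[p] (p ^ (n + cyclotomicExponent p))) (hχ : χ.IsPrimitive)
    (hev : χ.Even) (hord : ∃ j : ℕ, orderOf χ = p ^ j) :
    ratTwistedSymbolSum f χ ≠ 0 := by
  obtain ⟨hp3, ⟨hgood, hap⟩, -⟩ := hX
  subst hp3
  exact forall_odd_ratTwistedSymbolSum_ne_zero_of_lam_sharp_le (by decide) hf hgood hap hSP hL0 hμ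
    (by omega) hn χ hχ hev hord

/-- **X8, `λ(L♭_3(E)) ≤ 3` (in rank one: `λ♭ ∈ {1, 3}`; 23 + 9 of the 39 pairs): no character of
`Gal(ℚ_∞/ℚ)` of order `3ⁿ`, `n ≥ 2` even, has a vanishing Birch sum.** Nothing booked.
[cite: Sprung2017, §3 and Cor. 3.6] [cite: Pollack2003, Prop. 6.9 and Prop. 6.10] -/
theorem X8.forall_even_ratTwistedSymbolSum_ne_zero_of_lam_flat_le_three {p : ℕ} [Fact p.Prime]
    (hX : ClassX8 W p) (hf : IsNewformOf W f) {Lsharp Lflat : IwasawaAlgebra p}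
    (hSP : IsSprungPair f p (W.frobeniusTrace p) Lsharp Lflat) (hL0 : Lflat ≠ 0)
    (hμ : mu Lflat = 0) (h3 : lam Lflat ≤ 3) {n : ℕ} (hn : Even n) (hn0 : 0 < n)
    (χ : DirichletCharacter ℂ_[p] (p ^ (n + cyclotomicExponent p))) (hχ : χ.IsPrimitive)
    (hev : χ.Even) (hord : ∃ j : ℕ, orderOf χ = p ^ j) :
    ratTwistedSymbolSum f χ ≠ 0 := by
  obtain ⟨hp3, ⟨hgood, hap⟩, -⟩ := hX
  subst hp3
  exact forall_even_ratTwistedSymbolSum_ne_zero_of_lam_flat_le (by decide) hf hgood hap hSP hL0 hμ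
    (by omega) hn hn0 χ hχ hev hord

end X8

end Summit.BirchSwinnertonDyer.Rank1Residual.Supersingular

end
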